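import Literature.NumberTheory.DiophantineGeometry.AbcGyory2008RatOfNumberFieldsProofs
import Mathlib.RingTheory.DedekindDomain.Factorization
import HarnessLib

/-!
# Győry 2008, Theorem 2 ((3.9) and (3.10)) IS a consequence of Theorem 1 — the printed deduction (p. 292) in the kernel

`Literature/NumberTheory/DiophantineGeometry/AbcGyory2008ThmTwoProofs.lean` — proofs companion (theorems
only; no definition, no named fact) of `AbcGyory2008NumberFields.lean`, discharging its `TODO(prove)` for
Theorem 2: "The following theorem is a consequence of Theorem 1" (p. 286), "We now deduce Theorem 2 from
Theorem 1" (p. 292).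

* `Gyory2008.badPrimes_finite` — for `a, b, c ≠ 0` the set of bad primes is finite (only finitely many
  finite places have `|x|_v ≠ 1` for `x ≠ 0`), so Győry's `N_K`, `P_K` take no junk values under the
  hypotheses of Theorem 1;
* `Gyory2008.thm1Exponent_le_eventually` — the exponent `d (c₁₄ log* Δ_K + 19.2 log₃ N⋆) / log₂ N⋆` of
  (3.7) is `≤ ε` for `N ≥ N₀(K, ε)` (it tends to `0`);
* `Gyory2008.thm2_of_thm1` — **Theorem 2, (3.9)**, per field: `gyory2008_thm1 →` for every number field
  `K` and `ε > 0` there is `c₁₆ > 0` with `log H_K(a, b, c) < c₁₆ N_K(a, b, c)^{1+ε}` for all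
  `a, b, c ∈ K*`, `a + b + c = 0` — from (3.7) using `P ≤ N` (`maxNorm_le_radicalK`), `1/log* P ≤ 1`, and
  the eventual bound on the exponent (bounded radicals contribute a constant), and from (3.8) when there is
  no finite bad place (`N = 1`);
* `Gyory2008.thm2_uniform_of_thm1` — **Theorem 2, (3.10)**: for every `d` and `ε > 0` a constant `c₁₇ > 0`
  depending on `d, ε` ONLY with `log H_K(a, b, c) < c₁₇ (Δ_K N)^{1+ε}` whenever `[K : ℚ] = d` and
  `N > max(exp exp max(Δ_K, e), Δ_K^{2/ε})` (4.22) — the printed deduction p. 292–293 ((4.22) ⇒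
  `log* Δ_K ≤ log₃ N⋆`, `r + 1 ≤ d`, `P ≤ N`, `(log* Δ_K)^{3d−1} ≤ C(d) Δ_K^{1/2}`, `Δ_K < N^{ε/2}`, and the
  dichotomy "exponent `< ε/2` or `N ≤ N₀(d, ε)`", packaged as `rpow_exponent_le`);
* `Gyory2008.thm2_of_thm1_uniform` — (3.9) with the PRINTED dependence `c₁₆ = c₁₆(d, Δ_K, ε)` (uniform over
  the fields of given degree and discriminant), via `Units.rank K + 1 ≤ [K : ℚ]` (`units_rank_add_one_le_finrank`).
With these the `TODO(prove)` of `AbcGyory2008NumberFields.lean` for Theorem 2 is fully discharged.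
[cite: Gyory2008, §3 Theorem 2 (3.9)–(3.10) p. 287; proof p. 292–293]
-/

noncomputable section

open Real NumberField IsDedekindDomain
open Literature.NumberTheory.DiophantineGeometry.Dioph (logStar logStar_def one_le_logStar)
open Literature.IUT.LogVolume (ramIdx)

namespace Literature.NumberTheory.DiophantineGeometry

namespace Gyory2008

section Finite

variable {K : Type*} [Field K] [NumberField K]

/-- For `x ≠ 0` in a number field only finitely many finite places `v` have `|x|_v ≠ 1`
(`x = n/d` with `n, d ∈ 𝓞 K ∖ {0}`; such `v` divide `(n)` or `(d)`). [folklore] -/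
private theorem finite_setOf_valuation_ne_one {x : K} (hx : x ≠ 0) :
    {v : HeightOneSpectrum (𝓞 K) | v.valuation K x ≠ 1}.Finite := by
  obtain ⟨n, d, hd, rfl⟩ := IsFractionRing.div_surjective (A := 𝓞 K) x
  have hd0 : d ≠ 0 := nonZeroDivisors.ne_zero hd
  have hn0 : n ≠ 0 := by
    rintro rfl
    simp at hx
  apply ((Ideal.finite_factors ((Ideal.span_singleton_eq_bot (α := 𝓞 K)).not.mpr hn0)).union
    (Ideal.finite_factors ((Ideal.span_singleton_eq_bot (α := 𝓞 K)).not.mpr hd0))).subset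
  intro v hv
  simp only [Set.mem_setOf_eq, Set.mem_union] at hv ⊢
  by_contra hcon
  push Not at hcon
  apply hv
  have h1 : v.valuation K (algebraMap (𝓞 K) K n) = 1 := by
    have := (v.valuation_lt_one_iff_dvd (K := K) n).not.mpr hcon.1
    exact le_antisymm (v.valuation_le_one (K := K) n) (not_lt.mp this)
  have h2 : v.valuation K (algebraMap (𝓞 K) K d) = 1 := by
    have := (v.valuation_lt_one_iff_dvd (K := K) d).not.mpr hcon.2
    exact le_antisymm (v.valuation_le_one (K := K) d) (not_lt.mp this)
  rw [map_div₀, h1, h2, div_one]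

/-- **The bad primes of `(a : b : c)` with `a, b, c ≠ 0` form a finite set** (so `radicalK`, `maxNorm` —
and the tree's `radicalNorm`, `masserSupport` — take no junk value under the hypotheses of Theorem 1).
[cite: Gyory2008, §3 (3.2), p. 285] -/
theorem badPrimes_finite {a b c : K} (ha : a ≠ 0) (hb : b ≠ 0) (hc : c ≠ 0) :
    (badPrimes a b c).Finite := by
  apply (((finite_setOf_valuation_ne_one ha).union (finite_setOf_valuation_ne_one hb)).union
    (finite_setOf_valuation_ne_one hc)).subset
  intro v hv
  simp only [badPrimes, Set.mem_setOf_eq, Set.mem_union] at hv ⊢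
  by_contra hcon
  push Not at hcon
  obtain ⟨⟨h1, h2⟩, h3⟩ := hcon
  exact hv ⟨by rw [h1, h2], by rw [h2, h3]⟩

/-- `N_K(a, b, c) ≥ 1` (a product of natural numbers `≥ 1`, or the junk value `1`).
[cite: Gyory2008, §3 (3.2), p. 285] -/
theorem one_le_radicalK (a b c : K) : 1 ≤ radicalK a b c := by
  rw [radicalK_def]
  refine finprod_mem_induction (fun n : ℕ => 1 ≤ n) le_rfl (fun x y hx hy => one_le_mul hx hy) ?_
  intro v _
  exact Nat.one_le_iff_ne_zero.mpr (pow_ne_zero _ (by have := HeightOneSpectrum.one_lt_absNorm v; omega))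

/-- `radicalK = 1` when there is no bad prime. [cite: Gyory2008, §3 (3.2), p. 285] -/
theorem radicalK_eq_one_of_empty {a b c : K} (h : badPrimes a b c = ∅) : radicalK a b c = 1 := by
  rw [radicalK_def, h]; simp

end Finite

/-! ### The constants are non-negative -/

/-- `c₁₃ ≥ 0`. [cite: Gyory2008, §3 Theorem 1, p. 286] -/
theorem c13_nonneg (d r : ℕ) : 0 ≤ c13 d r := by
  unfold c13
  have h1 : (0 : ℝ) ≤ logStar d := le_trans zero_le_one (one_le_logStar _)
  split_ifs <;> positivity

/-- `c₁₄ ≥ 0` (`log d ≥ 0` for a natural number `d`). [cite: Gyory2008, §3 Theorem 1, p. 286] -/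
theorem c14_nonneg (d r : ℕ) : 0 ≤ c14 d r := by
  unfold c14
  have hlog : 0 ≤ Real.log (d : ℝ) := by
    rcases Nat.eq_zero_or_pos d with h | h
    · simp [h]
    · exact Real.log_nonneg (by exact_mod_cast h)
  split_ifs <;> positivity

/-- `c₁₅ ≥ 0`. [cite: Gyory2008, §3 Theorem 1 (3.8), p. 286] -/
theorem c15_nonneg (d r : ℕ) : 0 ≤ c15 d r := by
  unfold c15
  have h1 : (0 : ℝ) ≤ logStar (2 * d) := le_trans zero_le_one (one_le_logStar _)
  positivity

/-! ### The exponent of (3.7) tends to `0` -/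

/-- `log₃` is monotone on `[16, ∞)`. [folklore] -/
private theorem log_log_log_mono {x y : ℝ} (hx : 16 ≤ x) (hxy : x ≤ y) :
    Real.log (Real.log (Real.log x)) ≤ Real.log (Real.log (Real.log y)) := by
  have hx0 : 0 < x := by linarith
  have hl : 1 < Real.log x := by
    rw [Real.lt_log_iff_exp_lt hx0]; have he := Real.exp_one_lt_d9; linarith
  have hll : 0 < Real.log (Real.log x) := Real.log_pos hl
  exact Real.log_le_log hll (Real.log_le_log (by linarith) (Real.log_le_log hx0 hxy))

/-- `e < log 16` (`log 16 = 4 log 2 > 2.77`). [folklore] -/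
private theorem exp_one_lt_log_sixteen : Real.exp 1 < Real.log 16 := by
  have h4 : Real.log 16 = 4 * Real.log 2 := by
    rw [show (16 : ℝ) = 2 ^ 4 by norm_num, Real.log_pow]; norm_num
  rw [h4]; have := Real.log_two_gt_d9; have := Real.exp_one_lt_d9; linarith

/-- `log₂ N⋆ ≥ log₂ 16 > 1 > 0` and `log₃ N⋆ > 0`. [folklore] -/
private theorem one_lt_log_log_max (N : ℝ) : 1 < Real.log (Real.log (max N 16)) := by
  have h16 : (16 : ℝ) ≤ max N 16 := le_max_right _ _
  have hl : Real.exp 1 < Real.log (max N 16) :=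
    lt_of_lt_of_le exp_one_lt_log_sixteen (Real.log_le_log (by norm_num) h16)
  rwa [Real.lt_log_iff_exp_lt (lt_trans (Real.exp_pos 1) hl)]

/-- `log x ≤ 2 √x` for `x > 0`. [folklore] -/
private theorem log_le_two_mul_sqrt {x : ℝ} (hx : 0 < x) : Real.log x ≤ 2 * Real.sqrt x := by
  have hs : 0 < Real.sqrt x := Real.sqrt_pos.mpr hx
  have h1 : Real.log (Real.sqrt x) ≤ Real.sqrt x - 1 := Real.log_le_sub_one_of_pos hs
  have h2 : Real.log x = 2 * Real.log (Real.sqrt x) := by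
    conv_lhs => rw [← Real.sq_sqrt hx.le]
    rw [Real.log_pow]; norm_num
  rw [h2]; linarith

/-- **The exponent of (3.7) is eventually `≤ ε`:** for `C₁, C₂ ≥ 0` and `ε > 0` there is `N₀` with
`(C₁ + C₂ log₃ N⋆) / log₂ N⋆ ≤ ε` for all `N ≥ N₀` (`log₃ N⋆ = log log₂ N⋆ ≤ 2 √(log₂ N⋆)`).
[cite: Gyory2008, p. 292 ((4.24) and the choice of `N` after it)] -/
theorem thm1Exponent_le_eventually {C₁ C₂ ε : ℝ} (hC₁ : 0 ≤ C₁) (hC₂ : 0 ≤ C₂) (hε : 0 < ε) :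
    ∃ N₀ : ℝ, ∀ N : ℝ, N₀ ≤ N →
      (C₁ + C₂ * Real.log (Real.log (Real.log (max N 16)))) / Real.log (Real.log (max N 16)) ≤ ε := by
  set M : ℝ := max (2 * C₁ / ε) ((4 * C₂ / ε) ^ 2) with hM
  have hM0 : 0 ≤ M := le_trans (by positivity) (le_max_left _ _)
  refine ⟨max 16 (Real.exp (Real.exp M)), fun N hN => ?_⟩
  have hN16 : (16 : ℝ) ≤ N := le_trans (le_max_left _ _) hN
  have hmax : max N 16 = N := max_eq_left hN16
  rw [hmax]
  have hN0 : 0 < N := by linarith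
  set L : ℝ := Real.log (Real.log N) with hL
  have hL1 : 1 < L := by have := one_lt_log_log_max N; rwa [hmax] at this
  have hL0 : 0 < L := by linarith
  -- `L ≥ M`
  have hLM : M ≤ L := by
    have h1 : Real.exp (Real.exp M) ≤ N := le_trans (le_max_right _ _) hN
    have hlogN : 0 < Real.log N := by
      have : 1 < Real.log N := by
        have h16' : Real.exp 1 < Real.log N :=
          lt_of_lt_of_le exp_one_lt_log_sixteen (Real.log_le_log (by norm_num) hN16)
        have he : 1 < Real.exp 1 := by have := Real.exp_one_gt_d9; linarith
        linarith
      linarith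
    have h2 : Real.exp M ≤ Real.log N := by
      rw [Real.le_log_iff_exp_le hN0]; exact h1
    rw [hL, Real.le_log_iff_exp_le hlogN]; exact h2
  -- first term: `C₁ / L ≤ ε / 2`
  have hT1 : C₁ / L ≤ ε / 2 := by
    rw [div_le_iff₀ hL0]
    have : 2 * C₁ / ε ≤ L := le_trans (le_max_left _ _) hLM
    rw [div_le_iff₀ hε] at this
    linarith
  -- second term: `C₂ log L / L ≤ 2 C₂ / √L ≤ ε / 2`
  have hsqrtL : 0 < Real.sqrt L := Real.sqrt_pos.mpr hL0
  have hT2 : C₂ * Real.log L / L ≤ ε / 2 := by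
    have hlogL : Real.log L ≤ 2 * Real.sqrt L := log_le_two_mul_sqrt hL0
    have h1 : C₂ * Real.log L / L ≤ C₂ * (2 * Real.sqrt L) / L :=
      div_le_div_of_nonneg_right (mul_le_mul_of_nonneg_left hlogL hC₂) hL0.le
    have h2 : C₂ * (2 * Real.sqrt L) / L = 2 * C₂ / Real.sqrt L := by
      rw [div_eq_div_iff hL0.ne' hsqrtL.ne']
      linear_combination (2 * C₂) * Real.mul_self_sqrt hL0.le
    rw [h2] at h1
    -- `√L ≥ 4 C₂ / ε`
    have hsq : (4 * C₂ / ε) ^ 2 ≤ L := le_trans (le_max_right _ _) hLM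
    have h4 : 4 * C₂ / ε ≤ Real.sqrt L := by
      rw [← Real.sqrt_sq (show 0 ≤ 4 * C₂ / ε by positivity)]
      exact Real.sqrt_le_sqrt hsq
    have h5 : 2 * C₂ / Real.sqrt L ≤ ε / 2 := by
      rw [div_le_iff₀ hsqrtL]
      rw [div_le_iff₀ hε] at h4
      nlinarith
    linarith
  calc (C₁ + C₂ * Real.log L) / L = C₁ / L + C₂ * Real.log L / L := by ring
    _ ≤ ε / 2 + ε / 2 := add_le_add hT1 hT2
    _ = ε := by ring

/-- The exponent of (3.7) on a bounded range: for `N ≤ N₀`,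
`(C₁ + C₂ log₃ N⋆)/log₂ N⋆ ≤ (C₁ + C₂ log₃ max(N₀,16)⋆) / 1` (`log₂ N⋆ > 1`). [folklore] -/
private theorem exponent_le_of_le {C₁ C₂ N N₀ : ℝ} (hC₁ : 0 ≤ C₁) (hC₂ : 0 ≤ C₂) (hN : N ≤ N₀) :
    (C₁ + C₂ * Real.log (Real.log (Real.log (max N 16)))) / Real.log (Real.log (max N 16)) ≤
      C₁ + C₂ * Real.log (Real.log (Real.log (max N₀ 16))) := by
  have hden : 1 < Real.log (Real.log (max N 16)) := one_lt_log_log_max N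
  have hℓ₃ : 0 ≤ Real.log (Real.log (Real.log (max N 16))) := (Real.log_pos hden).le
  have hmono : Real.log (Real.log (Real.log (max N 16))) ≤ Real.log (Real.log (Real.log (max N₀ 16))) :=
    log_log_log_mono (le_max_right _ _) (max_le_max hN le_rfl)
  have hnum0 : 0 ≤ C₁ + C₂ * Real.log (Real.log (Real.log (max N 16))) := by positivity
  calc (C₁ + C₂ * Real.log (Real.log (Real.log (max N 16)))) / Real.log (Real.log (max N 16))
      ≤ (C₁ + C₂ * Real.log (Real.log (Real.log (max N 16)))) / 1 :=
        div_le_div_of_nonneg_left hnum0 one_pos hden.le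
    _ ≤ C₁ + C₂ * Real.log (Real.log (Real.log (max N₀ 16))) := by rw [div_one]; nlinarith

/-- **Uniform absorption of the exponent:** for `C₁, C₂ ≥ 0` and `ε > 0` there is `K₀ ≥ 1` with
`N^{(C₁ + C₂ log₃ N⋆)/log₂ N⋆} ≤ K₀ N^ε` for every real `N ≥ 1`. [cite: Gyory2008, p. 292] -/
theorem rpow_exponent_le {C₁ C₂ ε : ℝ} (hC₁ : 0 ≤ C₁) (hC₂ : 0 ≤ C₂) (hε : 0 < ε) :
    ∃ K₀ : ℝ, 1 ≤ K₀ ∧ ∀ N : ℝ, 1 ≤ N →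
      N ^ ((C₁ + C₂ * Real.log (Real.log (Real.log (max N 16)))) / Real.log (Real.log (max N 16))) ≤
        K₀ * N ^ ε := by
  obtain ⟨N₀, hN₀⟩ := thm1Exponent_le_eventually hC₁ hC₂ hε
  set E₀ : ℝ := C₁ + C₂ * Real.log (Real.log (Real.log (max N₀ 16))) with hE₀
  have hE₀0 : 0 ≤ E₀ := by
    have : 0 ≤ Real.log (Real.log (Real.log (max N₀ 16))) := (Real.log_pos (one_lt_log_log_max N₀)).le
    positivity
  set K₀ : ℝ := (max N₀ 1) ^ E₀ with hK₀
  have hK₀1 : 1 ≤ K₀ := Real.one_le_rpow (le_max_right _ _) hE₀0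
  refine ⟨K₀, hK₀1, fun N hN1 => ?_⟩
  have hNε : 1 ≤ N ^ ε := Real.one_le_rpow hN1 hε.le
  rcases le_or_gt N₀ N with h | h
  · -- large `N`: the exponent is `≤ ε`
    calc N ^ ((C₁ + C₂ * Real.log (Real.log (Real.log (max N 16)))) / Real.log (Real.log (max N 16)))
        ≤ N ^ ε := Real.rpow_le_rpow_of_exponent_le hN1 (hN₀ N h)
      _ = 1 * N ^ ε := (one_mul _).symm
      _ ≤ K₀ * N ^ ε := mul_le_mul_of_nonneg_right hK₀1 (by positivity)
  · -- small `N`: the exponent is bounded by `E₀`, and `N ≤ N₀`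
    have hexp := exponent_le_of_le hC₁ hC₂ h.le
    calc N ^ ((C₁ + C₂ * Real.log (Real.log (Real.log (max N 16)))) / Real.log (Real.log (max N 16)))
        ≤ N ^ E₀ := Real.rpow_le_rpow_of_exponent_le hN1 hexp
      _ ≤ (max N₀ 1) ^ E₀ := Real.rpow_le_rpow (by linarith) (le_trans h.le (le_max_left _ _)) hE₀0
      _ = K₀ * 1 := (mul_one _).symm
      _ ≤ K₀ * N ^ ε := mul_le_mul_of_nonneg_left hNε (by linarith)

/-! ### Theorem 2, (3.9), from Theorem 1 -/

/-- **Győry 2008, Theorem 2 (3.9), deduced from Theorem 1** (as on p. 292): if `gyory2008_thm1` holds then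
for every number field `K` and every `ε > 0` there is `c₁₆ > 0` (depending on `K` and `ε`) such that
`log H_K(a, b, c) < c₁₆ · N_K(a, b, c)^{1+ε}` for all `a, b, c ∈ K*` with `a + b + c = 0`. Proof: with at
least one finite bad place, (3.7) gives `log H_K < A (P/log* P) N^{e(N)}` with
`A = c₁₃ Δ^{3/2} (log* Δ)^{3d−1} ≥ 0`, `P/log* P ≤ P ≤ N` (`maxNorm_le_radicalK`, the bad primes being
finitely many: `badPrimes_finite`) and `N^{e(N)} ≤ K₀ N^ε` (`rpow_exponent_le`); with no finite bad place,
(3.8) gives `log H_K < B = c₁₅ Δ^{1/2} (log* Δ)^d` and `N = 1`. Take `c₁₆ = A K₀ + B + 1`.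
[cite: Gyory2008, §3 Theorem 2 (3.9) p. 287; proof p. 292] -/
theorem thm2_of_thm1 (hG : gyory2008_thm1) (K : Type) [Field K] [NumberField K] {ε : ℝ} (hε : 0 < ε) :
    ∃ c₁₆ : ℝ, 0 < c₁₆ ∧ ∀ a b c : K, a ≠ 0 → b ≠ 0 → c ≠ 0 → a + b + c = 0 →
      Real.log (Height.mulHeight ![a, b, c]) < c₁₆ * (radicalK a b c : ℝ) ^ (1 + ε) := by
  set d : ℕ := Module.finrank ℚ K with hd
  set r : ℕ := Units.rank K with hr
  set Δ : ℝ := |(discr K : ℝ)| with hΔ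
  set A : ℝ := c13 d r * Δ ^ (3 / 2 : ℝ) * logStar Δ ^ (3 * d - 1) with hA
  set B : ℝ := c15 d r * Δ ^ (1 / 2 : ℝ) * logStar Δ ^ d with hB
  have hΔ0 : 0 ≤ Δ := abs_nonneg _
  have hls : 0 ≤ logStar Δ := le_trans zero_le_one (one_le_logStar _)
  have hA0 : 0 ≤ A := by have := c13_nonneg d r; positivity
  have hB0 : 0 ≤ B := by have := c15_nonneg d r; positivity
  -- the exponent's constants `C₁ = d c₁₄ log* Δ`, `C₂ = 19.2 d`
  set C₁ : ℝ := d * (c14 d r * logStar Δ) with hC₁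
  set C₂ : ℝ := d * 19.2 with hC₂
  have hC₁0 : 0 ≤ C₁ := by have := c14_nonneg d r; positivity
  have hC₂0 : 0 ≤ C₂ := by positivity
  obtain ⟨K₀, hK₀1, hK₀⟩ := rpow_exponent_le hC₁0 hC₂0 hε
  refine ⟨A * K₀ + B + 1, by positivity, fun a b c ha hb hc habc => ?_⟩
  have hN1 : (1 : ℝ) ≤ (radicalK a b c : ℝ) := by exact_mod_cast one_le_radicalK a b c
  have hN0 : (0 : ℝ) < (radicalK a b c : ℝ) := by linarith
  have hNpow1 : 1 ≤ (radicalK a b c : ℝ) ^ (1 + ε) := Real.one_le_rpow hN1 (by linarith)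
  have hfin := badPrimes_finite ha hb hc
  rcases Set.eq_empty_or_nonempty (badPrimes a b c) with h0 | hne
  · -- no finite bad place: (3.8)
    have h38 := thm1_units hG ha hb hc habc h0
    calc Real.log (Height.mulHeight ![a, b, c]) < B := h38
      _ ≤ B * (radicalK a b c : ℝ) ^ (1 + ε) := le_mul_of_one_le_right hB0 hNpow1
      _ ≤ (A * K₀ + B + 1) * (radicalK a b c : ℝ) ^ (1 + ε) := by
          apply mul_le_mul_of_nonneg_right _ (by positivity)
          nlinarith
  · -- at least one finite bad place: (3.7)
    have h37 := thm1_general hG ha hb hc habc hne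
    -- `P / log* P ≤ P ≤ N`
    have hP0 : (0 : ℝ) ≤ (maxNorm a b c : ℝ) := Nat.cast_nonneg _
    have hPN : (maxNorm a b c : ℝ) / logStar (maxNorm a b c) ≤ (radicalK a b c : ℝ) := by
      calc (maxNorm a b c : ℝ) / logStar (maxNorm a b c) ≤ (maxNorm a b c : ℝ) / 1 :=
            div_le_div_of_nonneg_left hP0 one_pos (one_le_logStar _)
        _ ≤ (radicalK a b c : ℝ) := by
            rw [div_one]; exact_mod_cast maxNorm_le_radicalK hfin hne
    -- the exponent
    have hexpeq : thm1Exponent d r Δ (radicalK a b c : ℝ) =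
        (C₁ + C₂ * Real.log (Real.log (Real.log (max (radicalK a b c : ℝ) 16)))) /
          Real.log (Real.log (max (radicalK a b c : ℝ) 16)) := by
      rw [thm1Exponent_def, hC₁, hC₂]; ring
    have hpow := hK₀ (radicalK a b c : ℝ) hN1
    rw [← hexpeq] at hpow
    have hfrac0 : 0 ≤ (maxNorm a b c : ℝ) / logStar (maxNorm a b c) := by
      have := one_le_logStar (maxNorm a b c : ℝ); positivity
    have hrpow0 : 0 ≤ (radicalK a b c : ℝ) ^ thm1Exponent d r Δ (radicalK a b c : ℝ) :=
      Real.rpow_nonneg hN0.le _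
    calc Real.log (Height.mulHeight ![a, b, c])
        < A * ((maxNorm a b c : ℝ) / logStar (maxNorm a b c)) *
            (radicalK a b c : ℝ) ^ thm1Exponent d r Δ (radicalK a b c : ℝ) := by
          rw [hA]; exact h37
      _ ≤ A * (radicalK a b c : ℝ) * (K₀ * (radicalK a b c : ℝ) ^ ε) := by
          apply mul_le_mul (mul_le_mul_of_nonneg_left hPN hA0) hpow hrpow0 (by positivity)
      _ = A * K₀ * (radicalK a b c : ℝ) ^ (1 + ε) := by
          rw [Real.rpow_add hN0, Real.rpow_one]; ring
      _ ≤ (A * K₀ + B + 1) * (radicalK a b c : ℝ) ^ (1 + ε) := by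
          apply mul_le_mul_of_nonneg_right _ (by positivity)
          linarith


/-! ### Theorem 2, (3.10): the constant depends on `d` and `ε` only -/

section Uniform

/-- "Using the fact that `r + 1 ≤ d`" (p. 292): the unit rank `r = r₁ + r₂ − 1` and the degree
`d = r₁ + 2 r₂` of a number field satisfy `r + 1 ≤ d` — the step that makes the constants of Theorem 2
depend on `d` (not on `r`). [cite: Gyory2008, §4, proof of Theorem 2, p. 292] -/
theorem units_rank_add_one_le_finrank (K : Type*) [Field K] [NumberField K] :
    Units.rank K + 1 ≤ Module.finrank ℚ K := by
  have h1 := InfinitePlace.card_eq_nrRealPlaces_add_nrComplexPlaces (K := K)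
  have h2 := InfinitePlace.card_add_two_mul_card_eq_rank (K := K)
  have h3 : 0 < Fintype.card (InfinitePlace K) := Fintype.card_pos
  unfold Units.rank
  omega

/-- For `r ≤ d`: `c₁₃(d, r) ≤ Σ_{r' ≤ d} c₁₃(d, r')`, a bound depending on `d` only. [folklore] -/
private theorem c13_le_sum {d r : ℕ} (h : r ≤ d) :
    c13 d r ≤ ∑ r' ∈ Finset.range (d + 1), c13 d r' :=
  Finset.single_le_sum (f := fun r' => c13 d r') (fun i _ => c13_nonneg d i)
    (Finset.mem_range.mpr (Nat.lt_succ_of_le h))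

/-- For `r ≤ d`: `c₁₄(d, r) ≤ Σ_{r' ≤ d} c₁₄(d, r')`. [folklore] -/
private theorem c14_le_sum {d r : ℕ} (h : r ≤ d) :
    c14 d r ≤ ∑ r' ∈ Finset.range (d + 1), c14 d r' :=
  Finset.single_le_sum (f := fun r' => c14 d r') (fun i _ => c14_nonneg d i)
    (Finset.mem_range.mpr (Nat.lt_succ_of_le h))

/-- For `r ≤ d`: `c₁₅(d, r) ≤ Σ_{r' ≤ d} c₁₅(d, r')`. [folklore] -/
private theorem c15_le_sum {d r : ℕ} (h : r ≤ d) :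
    c15 d r ≤ ∑ r' ∈ Finset.range (d + 1), c15 d r' :=
  Finset.single_le_sum (f := fun r' => c15 d r') (fun i _ => c15_nonneg d i)
    (Finset.mem_range.mpr (Nat.lt_succ_of_le h))

/-- `exp exp max(Δ, e) ≥ exp 4 ≥ 16`. [folklore] -/
private theorem sixteen_le_exp_exp (Δ : ℝ) : 16 ≤ Real.exp (Real.exp (max Δ (Real.exp 1))) := by
  have h1 : (2 : ℝ) ≤ Real.exp 1 := by have := Real.add_one_le_exp (1 : ℝ); linarith
  have h2 : (4 : ℝ) ≤ Real.exp 2 := by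
    have : Real.exp 2 = Real.exp 1 * Real.exp 1 := by rw [← Real.exp_add]; norm_num
    rw [this]; nlinarith [Real.exp_pos 1]
  have h3 : (2 : ℝ) ≤ max Δ (Real.exp 1) := le_trans h1 (le_max_right _ _)
  have h4 : (4 : ℝ) ≤ Real.exp (max Δ (Real.exp 1)) := le_trans h2 (Real.exp_le_exp.mpr h3)
  have h5 : (16 : ℝ) ≤ Real.exp 4 := by
    have : Real.exp 4 = Real.exp 2 * Real.exp 2 := by rw [← Real.exp_add]; norm_num
    rw [this]; nlinarith [Real.exp_pos 2]
  exact le_trans h5 (Real.exp_le_exp.mpr h4)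

/-- The first step of the proof of (3.10) (p. 292): `N > exp exp max(Δ_K, e)` implies
`log* Δ_K ≤ log₃ N⋆` (indeed `<`). [cite: Gyory2008, p. 292 (after (4.22))] -/
private theorem logStar_lt_log₃ {Δ N : ℝ} (hΔ : 0 < Δ)
    (hN : Real.exp (Real.exp (max Δ (Real.exp 1))) < N) :
    logStar Δ < Real.log (Real.log (Real.log (max N 16))) := by
  have h16 : 16 ≤ N := le_trans (sixteen_le_exp_exp Δ) hN.le
  rw [max_eq_left h16]
  have hN0 : 0 < N := by linarith
  have h1 : Real.exp (max Δ (Real.exp 1)) < Real.log N := by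
    rwa [Real.lt_log_iff_exp_lt hN0]
  have hlogN0 : 0 < Real.log N := lt_trans (Real.exp_pos _) h1
  have h2 : max Δ (Real.exp 1) < Real.log (Real.log N) := by
    rwa [Real.lt_log_iff_exp_lt hlogN0]
  have hmax0 : 0 < max Δ (Real.exp 1) := lt_of_lt_of_le (Real.exp_pos 1) (le_max_right _ _)
  have h3 : Real.log (max Δ (Real.exp 1)) < Real.log (Real.log (Real.log N)) :=
    Real.log_lt_log hmax0 h2
  refine lt_of_le_of_lt ?_ h3
  rw [logStar_def]
  apply max_le
  · rw [Real.le_log_iff_exp_le hmax0]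
    exact le_max_right _ _
  · exact Real.log_le_log hΔ (le_max_left _ _)

/-- `(log* Δ)^m ≤ (2m)^m · Δ^{1/2}` for `Δ ≥ 1`, `m ≥ 1` (from `log Δ ≤ 2m · Δ^{1/(2m)}`); the paper's
"`(log* Δ_K)^{3d−1} ≤ (3d)^{3d−1} Δ_K^{1/2}`" with a slightly larger constant. [cite: Gyory2008, p. 292] -/
private theorem logStar_pow_le {Δ : ℝ} (hΔ : 1 ≤ Δ) {m : ℕ} (hm : 1 ≤ m) :
    logStar Δ ^ m ≤ (2 * m : ℝ) ^ m * Δ ^ (1 / 2 : ℝ) := by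
  have hΔ0 : 0 ≤ Δ := by linarith
  have hm1 : (1 : ℝ) ≤ m := by exact_mod_cast hm
  have hm0 : (0 : ℝ) < m := by linarith
  have ht0 : (0 : ℝ) < 1 / (2 * m) := by positivity
  have h1 : Real.log Δ ≤ Δ ^ (1 / (2 * (m : ℝ))) / (1 / (2 * m)) := Real.log_le_rpow_div hΔ0 ht0
  have h2 : Δ ^ (1 / (2 * (m : ℝ))) / (1 / (2 * m)) = 2 * m * Δ ^ (1 / (2 * (m : ℝ))) := by
    rw [div_div_eq_mul_div, div_one, mul_comm]
  have hΔt : 1 ≤ Δ ^ (1 / (2 * (m : ℝ))) := Real.one_le_rpow hΔ ht0.le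
  have h2m : (1 : ℝ) ≤ 2 * m := by linarith
  have h3 : logStar Δ ≤ 2 * m * Δ ^ (1 / (2 * (m : ℝ))) := by
    rw [logStar_def]
    apply max_le
    · exact one_le_mul_of_one_le_of_one_le h2m hΔt
    · rw [← h2]; exact h1
  have h4 : logStar Δ ^ m ≤ (2 * m * Δ ^ (1 / (2 * (m : ℝ)))) ^ m :=
    pow_le_pow_left₀ (le_trans zero_le_one (one_le_logStar Δ)) h3 m
  have htm : 1 / (2 * (m : ℝ)) * (m : ℝ) = 1 / 2 := by
    field_simp
  have h5 : (Δ ^ (1 / (2 * (m : ℝ)))) ^ m = Δ ^ (1 / 2 : ℝ) := by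
    rw [← Real.rpow_natCast (Δ ^ (1 / (2 * (m : ℝ)))) m, ← Real.rpow_mul hΔ0, htm]
  calc logStar Δ ^ m ≤ (2 * m * Δ ^ (1 / (2 * (m : ℝ)))) ^ m := h4
    _ = (2 * m : ℝ) ^ m * (Δ ^ (1 / (2 * (m : ℝ)))) ^ m := mul_pow _ _ _
    _ = (2 * m : ℝ) ^ m * Δ ^ (1 / 2 : ℝ) := by rw [h5]

/-- **Győry 2008, Theorem 2 (3.10), deduced from Theorem 1** (the printed deduction, p. 292,
(4.22)–(4.24)): if `gyory2008_thm1` holds then for every degree `d` and every `ε > 0` there is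
`c₁₇ > 0`, DEPENDING ON `d` AND `ε` ONLY, such that for every number field `K` of degree `d` and all
`a, b, c ∈ K*` with `a + b + c = 0` and
`N_K(a, b, c) > max(exp exp max(Δ_K, e), Δ_K^{2/ε})` (4.22) one has
`log H_K(a, b, c) < c₁₇ (Δ_K N_K(a, b, c))^{1+ε}`. Proof as printed: (4.22) gives `log* Δ_K ≤ log₃ N⋆`,
hence the exponent of (3.7) is `≤ c₁₉ log₃ N⋆ / log₂ N⋆` with `c₁₉ = d (c₁₄ + 19.2)` (`c₁₄` bounded in
terms of `d` using `r + 1 ≤ d`, `units_rank_add_one_le_finrank`); `P / log* P ≤ P ≤ N`; `(log* Δ_K)^{3d−1} ≤ C(d) Δ_K^{1/2}`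
(`logStar_pow_le`); `Δ_K < N^{ε/2}` by (4.22); and `N^{c₁₉ log₃ N⋆ / log₂ N⋆} ≤ K₀(d, ε) N^{ε/2}`
(`rpow_exponent_le`, which packages the printed dichotomy "`c₁₉ log₃ N⋆ / log₂ N⋆ < ε/2`, or else
`N ≤ N₀(d, ε)`"). So `log H_K < c₁₃ Δ^{3/2} (log* Δ)^{3d−1} N · K₀ N^{ε/2} ≤ C₁₃(d) C(d) K₀ Δ² N^{1+ε/2}
< c₁₇ Δ N^{1+ε} ≤ c₁₇ (Δ N)^{1+ε}`. The value of `c₁₇` is not printed ("effectively computable"); here it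
is an explicit function of `d, ε` assembled in the proof.
[cite: Gyory2008, §3 Theorem 2 (3.10) p. 287; proof p. 292–293] -/
theorem thm2_uniform_of_thm1 (hG : gyory2008_thm1) (d : ℕ) {ε : ℝ} (hε : 0 < ε) :
    ∃ c₁₇ : ℝ, 0 < c₁₇ ∧ ∀ (K : Type) [Field K] [NumberField K], Module.finrank ℚ K = d →
      ∀ a b c : K, a ≠ 0 → b ≠ 0 → c ≠ 0 → a + b + c = 0 →
        max (Real.exp (Real.exp (max |(discr K : ℝ)| (Real.exp 1)))) (|(discr K : ℝ)| ^ (2 / ε)) <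
            (radicalK a b c : ℝ) →
        Real.log (Height.mulHeight ![a, b, c]) <
          c₁₇ * (|(discr K : ℝ)| * (radicalK a b c : ℝ)) ^ (1 + ε) := by
  -- constants depending on `d` (and `ε`) only
  set C13 : ℝ := ∑ r' ∈ Finset.range (d + 1), c13 d r' with hC13
  set C14 : ℝ := ∑ r' ∈ Finset.range (d + 1), c14 d r' with hC14
  have hC13_0 : 0 ≤ C13 := Finset.sum_nonneg fun i _ => c13_nonneg d i
  have hC14_0 : 0 ≤ C14 := Finset.sum_nonneg fun i _ => c14_nonneg d i
  set C₂ : ℝ := d * (C14 + 19.2) with hC₂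
  have hC₂0 : 0 ≤ C₂ := by positivity
  obtain ⟨K₀, hK₀1, hK₀⟩ := rpow_exponent_le (le_refl (0 : ℝ)) hC₂0 (half_pos hε)
  set m : ℕ := 3 * d - 1 with hm
  set CL : ℝ := (2 * m : ℝ) ^ m with hCL
  have hCL0 : 0 ≤ CL := by positivity
  have hK₀0 : 0 ≤ K₀ := le_trans zero_le_one hK₀1
  refine ⟨C13 * CL * K₀ + 1, by positivity, ?_⟩
  intro K _ _ hKd a b c ha hb hc habc hN
  set Δ : ℝ := |(discr K : ℝ)| with hΔ
  set N : ℝ := (radicalK a b c : ℝ) with hNdef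
  set r : ℕ := Units.rank K with hr
  have hΔ1 : 1 ≤ Δ := by rw [hΔ]; exact_mod_cast Int.one_le_abs (discr_ne_zero K)
  have hΔ0 : 0 < Δ := by linarith
  have hd1 : 1 ≤ d := by rw [← hKd]; exact Module.finrank_pos
  have hrd : r ≤ d := by rw [hr, ← hKd]; have := units_rank_add_one_le_finrank K; omega
  -- the two halves of (4.22)
  have hNexp : Real.exp (Real.exp (max Δ (Real.exp 1))) < N := lt_of_le_of_lt (le_max_left _ _) hN
  have hNΔ : Δ ^ (2 / ε) < N := lt_of_le_of_lt (le_max_right _ _) hN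
  have hN16 : 16 ≤ N := le_trans (sixteen_le_exp_exp Δ) hNexp.le
  have hN1 : 1 ≤ N := by linarith
  have hN0 : 0 < N := by linarith
  -- there is a finite bad place (`N > 1`), so (3.7) applies
  have hfin := badPrimes_finite ha hb hc
  have hne : (badPrimes a b c).Nonempty := by
    rw [Set.nonempty_iff_ne_empty]
    intro h0
    have h1 := radicalK_eq_one_of_empty h0
    have : N = 1 := by rw [hNdef, h1]; norm_num
    linarith
  have h37 := thm1_general hG ha hb hc habc hne
  -- (i) `P / log* P ≤ P ≤ N`
  have hP0 : (0 : ℝ) ≤ (maxNorm a b c : ℝ) := Nat.cast_nonneg _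
  have hF0 : 0 ≤ (maxNorm a b c : ℝ) / logStar (maxNorm a b c) := by
    have := one_le_logStar (maxNorm a b c : ℝ); positivity
  have hPN : (maxNorm a b c : ℝ) / logStar (maxNorm a b c) ≤ N := by
    calc (maxNorm a b c : ℝ) / logStar (maxNorm a b c) ≤ (maxNorm a b c : ℝ) / 1 :=
          div_le_div_of_nonneg_left hP0 one_pos (one_le_logStar _)
      _ ≤ N := by rw [div_one, hNdef]; exact_mod_cast maxNorm_le_radicalK hfin hne
  -- (ii) the exponent: `log* Δ ≤ log₃ N⋆`, `c₁₄ ≤ C14`, so `e(N) ≤ C₂ log₃ N⋆ / log₂ N⋆`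
  have hL2 : 1 < Real.log (Real.log (max N 16)) := one_lt_log_log_max N
  have hL2_0 : 0 < Real.log (Real.log (max N 16)) := by linarith
  have hL3_0 : 0 < Real.log (Real.log (Real.log (max N 16))) := Real.log_pos hL2
  have hstar : logStar Δ ≤ Real.log (Real.log (Real.log (max N 16))) := (logStar_lt_log₃ hΔ0 hNexp).le
  have hls0 : 0 ≤ logStar Δ := le_trans zero_le_one (one_le_logStar Δ)
  have hc14 : c14 d r ≤ C14 := c14_le_sum hrd
  have hc14_0 : 0 ≤ c14 d r := c14_nonneg d r
  have hd0 : (0 : ℝ) ≤ d := Nat.cast_nonneg _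
  have hexp : thm1Exponent d r Δ N ≤
      (0 + C₂ * Real.log (Real.log (Real.log (max N 16)))) / Real.log (Real.log (max N 16)) := by
    rw [thm1Exponent_def, zero_add]
    apply div_le_div_of_nonneg_right _ hL2_0.le
    have h1 : c14 d r * logStar Δ ≤ C14 * Real.log (Real.log (Real.log (max N 16))) :=
      mul_le_mul hc14 hstar hls0 hC14_0
    have h2 : c14 d r * logStar Δ + 19.2 * Real.log (Real.log (Real.log (max N 16))) ≤
        (C14 + 19.2) * Real.log (Real.log (Real.log (max N 16))) := by linarith
    calc (d : ℝ) * (c14 d r * logStar Δ + 19.2 * Real.log (Real.log (Real.log (max N 16))))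
        ≤ (d : ℝ) * ((C14 + 19.2) * Real.log (Real.log (Real.log (max N 16)))) :=
          mul_le_mul_of_nonneg_left h2 hd0
      _ = C₂ * Real.log (Real.log (Real.log (max N 16))) := by rw [hC₂]; ring
  have hpowE : N ^ thm1Exponent d r Δ N ≤ K₀ * N ^ (ε / 2) :=
    le_trans (Real.rpow_le_rpow_of_exponent_le hN1 hexp) (hK₀ N hN1)
  have hG0 : 0 ≤ N ^ thm1Exponent d r Δ N := Real.rpow_nonneg hN0.le _
  -- (iii) `c₁₃ ≤ C13`, `(log* Δ)^{3d−1} ≤ CL Δ^{1/2}`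
  have hc13 : c13 d r ≤ C13 := c13_le_sum hrd
  have hm1 : 1 ≤ m := by omega
  have hlogpow : logStar Δ ^ (3 * d - 1) ≤ CL * Δ ^ (1 / 2 : ℝ) := logStar_pow_le hΔ1 hm1
  have hΔ32 : 0 ≤ Δ ^ (3 / 2 : ℝ) := Real.rpow_nonneg hΔ0.le _
  have hA : c13 d r * Δ ^ (3 / 2 : ℝ) * logStar Δ ^ (3 * Module.finrank ℚ K - 1) ≤
      C13 * Δ ^ (3 / 2 : ℝ) * (CL * Δ ^ (1 / 2 : ℝ)) := by
    rw [hKd]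
    apply mul_le_mul (mul_le_mul_of_nonneg_right hc13 hΔ32) hlogpow (pow_nonneg hls0 _)
      (by positivity)
  have hA1_0 : 0 ≤ C13 * Δ ^ (3 / 2 : ℝ) * (CL * Δ ^ (1 / 2 : ℝ)) := by
    have : 0 ≤ Δ ^ (1 / 2 : ℝ) := Real.rpow_nonneg hΔ0.le _
    positivity
  -- (iv) `Δ < N^{ε/2}` from `N > Δ^{2/ε}`
  have hΔN : Δ < N ^ (ε / 2) := by
    have h := Real.rpow_lt_rpow (Real.rpow_nonneg hΔ0.le _) hNΔ (half_pos hε)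
    rwa [← Real.rpow_mul hΔ0.le, show 2 / ε * (ε / 2) = 1 by field_simp, Real.rpow_one] at h
  -- assemble
  have hmain : Real.log (Height.mulHeight ![a, b, c]) <
      C13 * Δ ^ (3 / 2 : ℝ) * (CL * Δ ^ (1 / 2 : ℝ)) * N * (K₀ * N ^ (ε / 2)) := by
    refine lt_of_lt_of_le h37 ?_
    rw [hKd] at hA ⊢
    exact mul_le_mul (mul_le_mul hA hPN hF0 hA1_0) hpowE hG0 (by positivity)
  have hΔsq : Δ ^ (3 / 2 : ℝ) * Δ ^ (1 / 2 : ℝ) = Δ * Δ := by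
    rw [← Real.rpow_add hΔ0]; norm_num; ring
  have hNpow : N * N ^ (ε / 2) = N ^ (1 + ε / 2) := by
    rw [Real.rpow_add hN0, Real.rpow_one]
  have hNpow2 : N ^ (ε / 2) * N ^ (1 + ε / 2) = N ^ (1 + ε) := by
    rw [← Real.rpow_add hN0]; ring_nf
  have hstep1 : C13 * Δ ^ (3 / 2 : ℝ) * (CL * Δ ^ (1 / 2 : ℝ)) * N * (K₀ * N ^ (ε / 2)) =
      C13 * CL * K₀ * (Δ * Δ) * N ^ (1 + ε / 2) := by
    rw [← hΔsq, ← hNpow]; ring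
  have hstep2 : C13 * CL * K₀ * (Δ * Δ) * N ^ (1 + ε / 2) ≤
      C13 * CL * K₀ * (Δ * N ^ (ε / 2)) * N ^ (1 + ε / 2) := by
    have h1 : Δ * Δ ≤ Δ * N ^ (ε / 2) := mul_le_mul_of_nonneg_left hΔN.le hΔ0.le
    have h2 : 0 ≤ N ^ (1 + ε / 2) := Real.rpow_nonneg hN0.le _
    have h3 : 0 ≤ C13 * CL * K₀ := by positivity
    exact mul_le_mul_of_nonneg_right (mul_le_mul_of_nonneg_left h1 h3) h2
  have hstep3 : C13 * CL * K₀ * (Δ * N ^ (ε / 2)) * N ^ (1 + ε / 2) =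
      C13 * CL * K₀ * (Δ * N ^ (1 + ε)) := by
    rw [← hNpow2]; ring
  have hΔpow : Δ ≤ Δ ^ (1 + ε) := Real.self_le_rpow_of_one_le hΔ1 (by linarith)
  have hprod : Δ * N ^ (1 + ε) ≤ (Δ * N) ^ (1 + ε) := by
    rw [Real.mul_rpow hΔ0.le hN0.le]
    exact mul_le_mul_of_nonneg_right hΔpow (Real.rpow_nonneg hN0.le _)
  have hprod0 : 0 ≤ (Δ * N) ^ (1 + ε) := Real.rpow_nonneg (by positivity) _
  calc Real.log (Height.mulHeight ![a, b, c])
      < C13 * Δ ^ (3 / 2 : ℝ) * (CL * Δ ^ (1 / 2 : ℝ)) * N * (K₀ * N ^ (ε / 2)) := hmain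
    _ = C13 * CL * K₀ * (Δ * Δ) * N ^ (1 + ε / 2) := hstep1
    _ ≤ C13 * CL * K₀ * (Δ * N ^ (ε / 2)) * N ^ (1 + ε / 2) := hstep2
    _ = C13 * CL * K₀ * (Δ * N ^ (1 + ε)) := hstep3
    _ ≤ C13 * CL * K₀ * (Δ * N) ^ (1 + ε) := mul_le_mul_of_nonneg_left hprod (by positivity)
    _ ≤ (C13 * CL * K₀ + 1) * (Δ * N) ^ (1 + ε) := by rw [add_mul, one_mul]; linarith

/-- **Győry 2008, Theorem 2 (3.9) with the printed dependence of the constant** — "`c₁₆ = c₁₆(d, Δ_K, ε)`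
is an effectively computable positive constant which depends only on `d`, `Δ_K` and `ε`" (p. 287):
if `gyory2008_thm1` holds then for every `d`, `Δ` and `ε > 0` there is `c₁₆ > 0` such that for every
number field `K` with `[K : ℚ] = d` and `|disc K| = Δ`, and all `a, b, c ∈ K*` with `a + b + c = 0`,
`log H_K(a, b, c) < c₁₆ N_K(a, b, c)^{1+ε}`. (The per-field form is `thm2_of_thm1`; here the constants of
its proof are bounded in terms of `d` via `r + 1 ≤ d` (`units_rank_add_one_le_finrank`), which is how p. 292 makes
them depend on `d, Δ_K, ε` only: with a finite bad place, (3.7), `P/log* P ≤ N` and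
`N^{e(N)} ≤ K₀(d, Δ, ε) N^ε` (`rpow_exponent_le`); with none, (3.8) and `N = 1`.)
[cite: Gyory2008, §3 Theorem 2 (3.9) p. 287; proof p. 292–293] -/
theorem thm2_of_thm1_uniform (hG : gyory2008_thm1) (d : ℕ) (Δ : ℝ) {ε : ℝ} (hε : 0 < ε) :
    ∃ c₁₆ : ℝ, 0 < c₁₆ ∧ ∀ (K : Type) [Field K] [NumberField K], Module.finrank ℚ K = d →
      |(discr K : ℝ)| = Δ → ∀ a b c : K, a ≠ 0 → b ≠ 0 → c ≠ 0 → a + b + c = 0 →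
        Real.log (Height.mulHeight ![a, b, c]) < c₁₆ * (radicalK a b c : ℝ) ^ (1 + ε) := by
  -- constants depending on `d`, `Δ`, `ε` only (through `Δ⁺ = max(Δ, 1)`, `= Δ` for an actual field)
  set Δ' : ℝ := max Δ 1 with hΔ'
  have hΔ'1 : 1 ≤ Δ' := le_max_right _ _
  have hΔ'0 : 0 ≤ Δ' := le_trans zero_le_one hΔ'1
  have hls' : 0 ≤ logStar Δ' := le_trans zero_le_one (one_le_logStar _)
  set C13 : ℝ := ∑ r' ∈ Finset.range (d + 1), c13 d r' with hC13
  set C14 : ℝ := ∑ r' ∈ Finset.range (d + 1), c14 d r' with hC14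
  set C15 : ℝ := ∑ r' ∈ Finset.range (d + 1), c15 d r' with hC15
  have hC13_0 : 0 ≤ C13 := Finset.sum_nonneg fun i _ => c13_nonneg d i
  have hC14_0 : 0 ≤ C14 := Finset.sum_nonneg fun i _ => c14_nonneg d i
  have hC15_0 : 0 ≤ C15 := Finset.sum_nonneg fun i _ => c15_nonneg d i
  set A : ℝ := C13 * Δ' ^ (3 / 2 : ℝ) * logStar Δ' ^ (3 * d - 1) with hA
  set B : ℝ := C15 * Δ' ^ (1 / 2 : ℝ) * logStar Δ' ^ d with hB
  have hA0 : 0 ≤ A := by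
    have : 0 ≤ Δ' ^ (3 / 2 : ℝ) := Real.rpow_nonneg hΔ'0 _
    positivity
  have hB0 : 0 ≤ B := by
    have : 0 ≤ Δ' ^ (1 / 2 : ℝ) := Real.rpow_nonneg hΔ'0 _
    positivity
  set C₁ : ℝ := d * (C14 * logStar Δ') with hC₁
  set C₂ : ℝ := d * 19.2 with hC₂
  have hC₁0 : 0 ≤ C₁ := by positivity
  have hC₂0 : 0 ≤ C₂ := by positivity
  obtain ⟨K₀, hK₀1, hK₀⟩ := rpow_exponent_le hC₁0 hC₂0 hε
  have hK₀0 : 0 ≤ K₀ := le_trans zero_le_one hK₀1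
  refine ⟨A * K₀ + B + 1, by positivity, ?_⟩
  intro K _ _ hKd hKΔ a b c ha hb hc habc
  set N : ℝ := (radicalK a b c : ℝ) with hNdef
  set r : ℕ := Units.rank K with hr
  have hΔ1 : 1 ≤ Δ := by rw [← hKΔ]; exact_mod_cast Int.one_le_abs (discr_ne_zero K)
  have hΔeq : Δ' = Δ := by rw [hΔ']; exact max_eq_left hΔ1
  have hΔ0 : 0 < Δ := by linarith
  have hrd : r ≤ d := by rw [hr, ← hKd]; have := units_rank_add_one_le_finrank K; omega
  have hN1 : (1 : ℝ) ≤ N := by rw [hNdef]; exact_mod_cast one_le_radicalK a b c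
  have hN0 : (0 : ℝ) < N := by linarith
  have hNpow1 : 1 ≤ N ^ (1 + ε) := Real.one_le_rpow hN1 (by linarith)
  have hNpow0 : 0 ≤ N ^ (1 + ε) := le_trans zero_le_one hNpow1
  have hfin := badPrimes_finite ha hb hc
  have hls0 : 0 ≤ logStar Δ := le_trans zero_le_one (one_le_logStar Δ)
  rcases Set.eq_empty_or_nonempty (badPrimes a b c) with h0 | hne
  · -- no finite bad place: (3.8), with `c₁₅(d, r) ≤ C15`
    have h38 := thm1_units hG ha hb hc habc h0
    rw [hKd, hKΔ] at h38
    have hc15 : c15 d r ≤ C15 := c15_le_sum hrd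
    have hB' : c15 d r * Δ ^ (1 / 2 : ℝ) * logStar Δ ^ d ≤ B := by
      rw [hB, hΔeq]
      have : 0 ≤ Δ ^ (1 / 2 : ℝ) := Real.rpow_nonneg hΔ0.le _
      exact mul_le_mul_of_nonneg_right (mul_le_mul_of_nonneg_right hc15 this) (pow_nonneg hls0 _)
    calc Real.log (Height.mulHeight ![a, b, c]) < c15 d r * Δ ^ (1 / 2 : ℝ) * logStar Δ ^ d := h38
      _ ≤ B := hB'
      _ ≤ B * N ^ (1 + ε) := le_mul_of_one_le_right hB0 hNpow1
      _ ≤ (A * K₀ + B + 1) * N ^ (1 + ε) := by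
          apply mul_le_mul_of_nonneg_right _ hNpow0
          nlinarith
  · -- at least one finite bad place: (3.7), with `c₁₃(d, r) ≤ C13`, `c₁₄(d, r) ≤ C14`
    have h37 := thm1_general hG ha hb hc habc hne
    rw [hKd, hKΔ] at h37
    -- `P / log* P ≤ P ≤ N`
    have hP0 : (0 : ℝ) ≤ (maxNorm a b c : ℝ) := Nat.cast_nonneg _
    have hF0 : 0 ≤ (maxNorm a b c : ℝ) / logStar (maxNorm a b c) := by
      have := one_le_logStar (maxNorm a b c : ℝ); positivity
    have hPN : (maxNorm a b c : ℝ) / logStar (maxNorm a b c) ≤ N := by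
      calc (maxNorm a b c : ℝ) / logStar (maxNorm a b c) ≤ (maxNorm a b c : ℝ) / 1 :=
            div_le_div_of_nonneg_left hP0 one_pos (one_le_logStar _)
        _ ≤ N := by rw [div_one, hNdef]; exact_mod_cast maxNorm_le_radicalK hfin hne
    -- the exponent: `e(N) ≤ (C₁ + C₂ log₃ N⋆) / log₂ N⋆`
    have hL2 : 1 < Real.log (Real.log (max N 16)) := one_lt_log_log_max N
    have hL2_0 : 0 < Real.log (Real.log (max N 16)) := by linarith
    have hL3_0 : 0 < Real.log (Real.log (Real.log (max N 16))) := Real.log_pos hL2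
    have hc14 : c14 d r ≤ C14 := c14_le_sum hrd
    have hd0 : (0 : ℝ) ≤ d := Nat.cast_nonneg _
    have hexp : thm1Exponent d r Δ N ≤
        (C₁ + C₂ * Real.log (Real.log (Real.log (max N 16)))) / Real.log (Real.log (max N 16)) := by
      rw [thm1Exponent_def, hC₁, hC₂, hΔeq]
      apply div_le_div_of_nonneg_right _ hL2_0.le
      have h1 : c14 d r * logStar Δ ≤ C14 * logStar Δ := mul_le_mul_of_nonneg_right hc14 hls0
      calc (d : ℝ) * (c14 d r * logStar Δ + 19.2 * Real.log (Real.log (Real.log (max N 16))))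
          ≤ (d : ℝ) * (C14 * logStar Δ + 19.2 * Real.log (Real.log (Real.log (max N 16)))) :=
            mul_le_mul_of_nonneg_left (by linarith) hd0
        _ = d * (C14 * logStar Δ) + d * 19.2 * Real.log (Real.log (Real.log (max N 16))) := by ring
    have hpowE : N ^ thm1Exponent d r Δ N ≤ K₀ * N ^ ε :=
      le_trans (Real.rpow_le_rpow_of_exponent_le hN1 hexp) (hK₀ N hN1)
    have hG0 : 0 ≤ N ^ thm1Exponent d r Δ N := Real.rpow_nonneg hN0.le _
    -- `c₁₃ Δ^{3/2} (log* Δ)^{3d−1} ≤ A`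
    have hc13 : c13 d r ≤ C13 := c13_le_sum hrd
    have hΔ32 : 0 ≤ Δ ^ (3 / 2 : ℝ) := Real.rpow_nonneg hΔ0.le _
    have hA' : c13 d r * Δ ^ (3 / 2 : ℝ) * logStar Δ ^ (3 * d - 1) ≤ A := by
      rw [hA, hΔeq]
      exact mul_le_mul_of_nonneg_right (mul_le_mul_of_nonneg_right hc13 hΔ32) (pow_nonneg hls0 _)
    calc Real.log (Height.mulHeight ![a, b, c])
        < c13 d r * Δ ^ (3 / 2 : ℝ) * logStar Δ ^ (3 * d - 1) *
            ((maxNorm a b c : ℝ) / logStar (maxNorm a b c)) * N ^ thm1Exponent d r Δ N := h37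
      _ ≤ A * N * (K₀ * N ^ ε) := mul_le_mul (mul_le_mul hA' hPN hF0 hA0) hpowE hG0 (by positivity)
      _ = A * K₀ * N ^ (1 + ε) := by
          rw [Real.rpow_add hN0, Real.rpow_one]; ring
      _ ≤ (A * K₀ + B + 1) * N ^ (1 + ε) := by
          apply mul_le_mul_of_nonneg_right _ hNpow0
          linarith

end Uniform

end Gyory2008

end Literature.NumberTheory.DiophantineGeometry
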